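import Mathlib
import Literature.NumberTheory.Transcendental.MZVWordShuffle
import Literature.NumberTheory.Transcendental.MultipleZetaStuffle
import HarnessLib

/-!
# Associators: non-commutative formal series, the pentagon equation, and Furusho's
# generalised double shuffle relation

Definitions file (Literature, `NumberTheory/Transcendental`) providing the vocabulary of
Drinfeld associators in which Furusho's two theorems "pentagon ⇒ double shuffle"
[Furusho2011, Thm 1.2] and "pentagon ⇒ hexagons" [Furusho2010, Thm 1] are stated, following
§2 of [Furusho2011] (p. 5 of arXiv:0808.0319) verbatim wherever Lean allows it.

## Contents

1. `NCSeries α R` — the ring `R⟨⟨α⟩⟩` of **non-commutative formal power series** over the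
   alphabet `α` with coefficients in a (semi)ring `R`: functions on words `List α` (the free monoid
   on `α`) with the Cauchy (concatenation–convolution) product
   `(φ ψ)(w) = Σ_{w = u v} φ(u) ψ(v)` (`NCSeries.mul_apply`, the deconcatenations `u v = w` being
   `NCSeries.splits w`), unit and constants `NCSeries.C`, the `R`-algebra structure, coefficient
   maps `NCSeries.coeff w` (Furusho's `c_W(φ)`), monomials / letters, change of coefficients
   `NCSeries.map`, weight truncation `NCSeries.trunc` and the weight-truncated substitution of
   letters `NCSeries.evalTrunc N v φ = Σ_{|w| ≤ N} c_w(φ) v(w)` into an `R`-algebra (Furusho's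
   `φ(ι(X₀), ι(X₁))`, weight by weight), and `NCSeries.exp` for series without constant term.
   Furusho's `U𝔉₂ = k⟨⟨X₀, X₁⟩⟩` is `NCSeries Bool k` with `X₀ = letter false`, `X₁ = letter true`
   — the alphabet `Bool` and this dictionary are those of the tree's binary words
   `MZV.binaryWord s = 0^{s₁-1} 1 ⋯ 0^{s_k-1} 1` (`MZVSimplexRep.lean`), so that the word
   `X₀^{k₁-1}X₁ ⋯ X₀^{k_m-1}X₁` of [Furusho2011] is literally `MZV.binaryWord [k₁, …, k_m]`.
2. `NCSeries.IsGroupLike φ` — `φ` is **group-like**: constant term `1` and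
   `Δ φ = φ ⊗̂ φ` for the coproduct with `Δ(x) = x ⊗ 1 + 1 ⊗ x` on letters. Since
   `⟨Δ φ, u ⊗ v⟩ = Σ_{w} ⟨u ш v, w⟩ c_w(φ)` (the coproduct `Δ` is the transpose of the shuffle
   product `ш` of words: Racinet 2002, §2, paragraph after Prop. 2.8, "le produit de battage ш; ce
   dernier est dual du coproduit Δ", referring to Reutenauer 1993) the condition is stated
   coefficientwise, as it is used: `c_u(φ) c_v(φ) = Σ_{w ∈ u ш v} c_w(φ)` for all words `u, v`,
   the shuffles being listed with multiplicity by the tree's `MZV.shuffleWord` (Ree's shuffle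
   relations; the two formulations are equivalent by the transposition formula).
3. `DrinfeldKohnoTrunc R ι N` — the **weight-truncated Drinfeld–Kohno algebra**: the quotient of
   the free `R`-algebra on symbols `t i j` (`i j : ι`) by Furusho's defining relations of the pure
   braid Lie algebra `𝔞₄` (for `ι = Fin 4`; [Furusho2011, §2]) `t_ii = 0`, `t_ij = t_ji`,
   `[t_ij, t_ik + t_jk] = 0` (`i, j, k` distinct), `[t_ij, t_kl] = 0` (`i, j, k, l` distinct),
   AND by all products of `N + 1` generators. As `U𝔞₄` is graded by the number of generators with
   finite-dimensional pieces, its completion `U𝔞₄^∧` is the limit of these truncations and an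
   identity between images of series holds in `U𝔞₄^∧ ⊗̂ R` iff it holds in every truncation; this
   is how identities of the completed algebra are stated here (no topology is needed).
4. `NCSeries.DrinfeldPentagon φ` — **Drinfeld's pentagon equation**
   `φ(t₁₂, t₂₃ + t₂₄) φ(t₁₃ + t₂₃, t₃₄) = φ(t₂₃, t₃₄) φ(t₁₂ + t₁₃, t₂₄ + t₃₄) φ(t₁₂, t₂₃)`
   [Furusho2011, §2, (pentagon)] = [Drinfeld1991], in every truncation (strands are indexed by
   `Fin 4 = {0, 1, 2, 3}`, so the paper's `t_ij` is `t (i-1) (j-1)`); the two **hexagon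
   equations** `NCSeries.DrinfeldHexagon μ φ`, `NCSeries.DrinfeldHexagonB μ φ`
   [Furusho2011, §2, (hexagon), (hexagon-b)] and `NCSeries.IsAssociatorPair μ φ` (the pair
   `(μ, φ)` satisfies the GT-relations: Drinfeld's associator set `M̲`, [Furusho2010, §1]).
5. `NCSeries.piY`, `NCSeries.corrLog`, `NCSeries.corr`, `NCSeries.seriesShuffleReg` — Furusho's
   `π_Y : k⟨⟨X₀,X₁⟩⟩ → k⟨⟨Y₁,Y₂,…⟩⟩`, the correction term
   `φ_corr = exp(Σ_{n ≥ 1} ((-1)ⁿ/n) c_{X₀ⁿ⁻¹X₁}(φ) Y₁ⁿ)` and the **series shuffle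
   regularisation** `φ_* = φ_corr · π_Y(φ)` [Furusho2011, §2]; `NCSeries.GeneralisedDoubleShuffle φ`
   — the **generalised double shuffle relation** `Δ_*(φ_*) = φ_* ⊗̂ φ_*` for the coproduct
   `Δ_*(Y_n) = Σ_{i=0}^{n} Y_i ⊗ Y_{n-i}` (`Y₀ := 1`). Series in the letters `Y_n` (`n ≥ 1`) are
   `NCSeries ℕ R` evaluated on lists of POSITIVE integers (`[n₁, …, n_m] ↔ Y_{n₁} ⋯ Y_{n_m}`; lists
   containing `0` index no word and every series built here vanishes on them). As `Δ_*` is the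
   algebra morphism transposed to Hoffman's harmonic (quasi-shuffle, "stuffle") product `∗` of
   indices — `⟨Δ_* ψ, u ⊗ v⟩ = ⟨ψ, u ∗ v⟩` (Racinet 2002, §2: `(k⟨Y⟩, ·, Δ_*)` is the Hopf
   algebra of non-commutative symmetric functions, its graded dual is the algebra `QSym` of
   quasi-symmetric functions — paragraph before Prop. 2.17 — and Prop. 2.17 is the case of two
   letters, `⟨Δ_* v, y_s ⊗ y_t⟩ = ⟨v, y_{s+t} + y_s y_t + y_t y_s⟩`; Hoffman 1997, §2 for `∗`) —
   the relation is stated coefficientwise with the tree's `MZV.stuffle`: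
   `c_u(φ_*) c_v(φ_*) = Σ_{w ∈ u ∗ v} c_w(φ_*)`.
6. The NAMED FACTS `furusho_pentagon_doubleShuffle` [Furusho2011, Thm 1.2] and
   `furusho_pentagon_hexagon` [Furusho2010, Thm 1].

## Design notes

* `NCSeries α R` is a `def` type synonym of `List α → R` (as Mathlib's `MvPowerSeries`), so that
  the pointwise `Pi` multiplication does not leak in; coefficients are read by application `φ w`
  (`NCSeries.coeff w` is the same map bundled `R`-linearly).
* Mathlib (checked 2026-08-15, `lean search`): `FreeAlgebra`, `RingQuot`, `MvPowerSeries`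
  (commuting variables only), `PowerSeries.exp`, `IsGroupLikeElem` (for genuine, non-completed
  coalgebras) exist; there is no ring of non-commutative formal power series, no Drinfeld–Kohno /
  infinitesimal braid algebra, no associator. Nothing here duplicates a Mathlib notion.
* Identities in completed algebras are stated in all weight truncations (item 3); only these are
  needed to extract the coefficientwise polynomial identities that routes use
  (`Summits/KontsevichZagierPeriods/…/Theses/FurushoPentagon.lean`, items PentagonInKZ and
  FurushoTransfer).

## Deliberately NOT here

The coproducts `Δ`, `Δ_*` as algebra morphisms into completed tensor squares and the proofs of the
two transposition formulas quoted in items 2 and 5 (we take the coefficientwise forms as the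
definitions and cite the equivalences); the 5-cycle form of the pentagon in `U𝔓₅`
[Furusho2011, Thm 2.1]; the groups `GRT₁`, `DMR₀` and their torsors; the KZ associator `Φ_KZ`
itself (its coefficients are regularised multiple zeta values, [Furusho2011, §1]); any proof of the
two named facts.

## References

* H. Furusho, *Double shuffle relation for associators*, Ann. of Math. 174 (2011), 341–360,
  §2 (p. 5 of arXiv:0808.0319), Thm 1.2. [Furusho2011]
* H. Furusho, *Pentagon and hexagon equations*, Ann. of Math. 171 (2010), 545–556, Thm 1
  (arXiv:math/0702128). [Furusho2010]
* V. G. Drinfel'd, *On quasitriangular quasi-Hopf algebras and on a group that is closely connected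
  with Gal(Q̄/Q)*, Leningrad Math. J. 2 (1991), 829–860. [Drinfeld1991]
* G. Racinet, *Doubles mélanges des polylogarithmes multiples aux racines de l'unité*, Publ. Math.
  IHÉS 95 (2002), 185–231, §2 (Prop. 2.8, definition of `Δ_*`, Prop. 2.17), Def. 3.1
  (arXiv:math/0202142, pp. 7–10, 13). [Racinet2002]
* C. Reutenauer, *Free Lie algebras*, Oxford (1993), §1.4 (shuffle product), Ch. 3 (Lie series and
  exponentials; Ree's theorem). [Reutenauer1993]
* M. E. Hoffman, *The algebra of multiple harmonic series*, J. Algebra 194 (1997), §2. [Hoffman1997]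
-/

noncomputable section

open scoped BigOperators

namespace Literature.NumberTheory.Transcendental

universe u v

/-! ## 1. Non-commutative formal power series -/

/-- **Non-commutative formal power series** `R⟨⟨α⟩⟩` over the alphabet `α` with coefficients in
`R`: all functions from words (the free monoid `List α`, product = concatenation) to `R`,
`φ = Σ_w c_w(φ) w` being the function `w ↦ c_w(φ)`. Furusho's `U𝔉₂ = k⟨⟨X₀, X₁⟩⟩` is
`NCSeries Bool k` (`false ↦ X₀`, `true ↦ X₁`). A `def` (not `abbrev`) so that the pointwise
product of functions is not picked up: the product is the Cauchy product (`NCSeries.mul_apply`).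
[cite: Furusho2011, §2] -/
def NCSeries (α : Type u) (R : Type v) : Type (max u v) := List α → R

namespace NCSeries

variable {α : Type u} {R : Type v}

/-- `R⟨⟨α⟩⟩` is inhabited (pointwise structure of `List α → R`). [folklore] -/
instance instInhabited [Inhabited R] : Inhabited (NCSeries α R) :=
  inferInstanceAs (Inhabited (List α → R))

/-- The zero series (pointwise). [folklore] -/
instance instZero [Zero R] : Zero (NCSeries α R) := inferInstanceAs (Zero (List α → R))

/-- Addition of series is coefficientwise. [folklore] -/
instance instAddCommMonoid [AddCommMonoid R] : AddCommMonoid (NCSeries α R) :=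
  inferInstanceAs (AddCommMonoid (List α → R))

/-- Subtraction/negation of series is coefficientwise. [folklore] -/
instance instAddCommGroup [AddCommGroup R] : AddCommGroup (NCSeries α R) :=
  inferInstanceAs (AddCommGroup (List α → R))

/-- Scalars act coefficientwise. [folklore] -/
instance instModule {S : Type*} [Semiring S] [AddCommMonoid R] [Module S R] :
    Module S (NCSeries α R) :=
  inferInstanceAs (Module S (List α → R))

/-- Two series are equal iff all their coefficients are. [folklore] -/
@[ext] theorem ext {R : Type v} {φ ψ : NCSeries α R} (h : ∀ w, φ w = ψ w) : φ = ψ := funext h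

/-- `c_w(0) = 0`. [folklore] -/
@[simp] theorem zero_apply [Zero R] (w : List α) : (0 : NCSeries α R) w = 0 := rfl

/-- `c_w(φ + ψ) = c_w(φ) + c_w(ψ)`. [folklore] -/
@[simp] theorem add_apply [AddCommMonoid R] (φ ψ : NCSeries α R) (w : List α) :
    (φ + ψ) w = φ w + ψ w := rfl

/-- `c_w(-φ) = -c_w(φ)`. [folklore] -/
@[simp] theorem neg_apply [AddCommGroup R] (φ : NCSeries α R) (w : List α) :
    (-φ) w = -φ w := rfl

/-- `c_w(φ - ψ) = c_w(φ) - c_w(ψ)`. [folklore] -/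
@[simp] theorem sub_apply [AddCommGroup R] (φ ψ : NCSeries α R) (w : List α) :
    (φ - ψ) w = φ w - ψ w := rfl

/-- `c_w(s • φ) = s • c_w(φ)`. [folklore] -/
@[simp] theorem smul_apply {S : Type*} [Semiring S] [AddCommMonoid R] [Module S R] (s : S)
    (φ : NCSeries α R) (w : List α) : (s • φ) w = s • φ w := rfl

section Semiring

variable [Semiring R]

/-- The coefficient map `c_w : R⟨⟨α⟩⟩ → R` (Furusho's `c_W(φ)`, the coefficient of the word
`W` in `φ`), as an `R`-linear map; `coeff w φ = φ w`. [cite: Furusho2011, §1] -/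
def coeff (w : List α) : NCSeries α R →ₗ[R] R := LinearMap.proj w

/-- `coeff w φ = φ w`. [folklore] -/
@[simp] theorem coeff_apply (w : List α) (φ : NCSeries α R) : coeff w φ = φ w := rfl

/-- The constant series `r` (coefficient `r` on the empty word, `0` elsewhere). [folklore] -/
def C (r : R) : NCSeries α R := fun w => match w with
  | [] => r
  | _ :: _ => 0

/-- `c_∅(C r) = r`. [folklore] -/
@[simp] theorem C_apply_nil (r : R) : (C r : NCSeries α R) [] = r := rfl

/-- `c_{a w}(C r) = 0`. [folklore] -/
@[simp] theorem C_apply_cons (r : R) (a : α) (w : List α) : (C r : NCSeries α R) (a :: w) = 0 :=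
  rfl

/-- `C 0 = 0`. [folklore] -/
@[simp] theorem C_zero : (C 0 : NCSeries α R) = 0 := by
  ext w; cases w <;> rfl

/-- `C (r + s) = C r + C s`. [folklore] -/
theorem C_add (r s : R) : (C (r + s) : NCSeries α R) = C r + C s := by
  ext w; cases w <;> simp

/-- The unit series `1` (coefficient `1` on the empty word). [folklore] -/
instance instOne : One (NCSeries α R) := ⟨C 1⟩

/-- `c_∅(1) = 1`. [folklore] -/
@[simp] theorem one_apply_nil : (1 : NCSeries α R) [] = 1 := rfl

/-- `c_{a w}(1) = 0`. [folklore] -/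
@[simp] theorem one_apply_cons (a : α) (w : List α) : (1 : NCSeries α R) (a :: w) = 0 := rfl

/-- `C 1 = 1`. [folklore] -/
@[simp] theorem C_one : (C 1 : NCSeries α R) = 1 := rfl

/-- The **deconcatenations** of a word `w`: the finite set of pairs `(u, v)` with `u v = w`
(`NCSeries.mem_splits`), indexed by the cut position `0 ≤ k ≤ |w|`. [folklore] -/
def splits (w : List α) : Finset (List α × List α) :=
  (Finset.univ : Finset (Fin (w.length + 1))).map
    ⟨fun k : Fin (w.length + 1) => (w.take k.1, w.drop k.1), fun i j h => Fin.ext (by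
      have hi := i.isLt
      have hj := j.isLt
      have h1 := congrArg (fun p : List α × List α => p.1.length) h
      simp only [List.length_take] at h1
      omega)⟩

/-- `(u, v) ∈ splits w ↔ u ++ v = w`. [folklore] -/
@[simp] theorem mem_splits {w : List α} {p : List α × List α} : p ∈ splits w ↔ p.1 ++ p.2 = w := by
  constructor
  · intro h
    obtain ⟨k, -, rfl⟩ := Finset.mem_map.mp h
    exact List.take_append_drop k w
  · intro h
    refine Finset.mem_map.mpr ⟨⟨p.1.length, ?_⟩, Finset.mem_univ _, ?_⟩
    · rw [← h, List.length_append]; omega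
    · obtain ⟨u, v⟩ := p
      subst h
      simp

/-- `([], w)` is a deconcatenation of `w`. [folklore] -/
theorem nil_self_mem_splits (w : List α) : ([], w) ∈ splits w := mem_splits.mpr (by simp)

/-- `(w, [])` is a deconcatenation of `w`. [folklore] -/
theorem self_nil_mem_splits (w : List α) : (w, []) ∈ splits w := mem_splits.mpr (by simp)

/-- The **Cauchy product** of non-commutative series:
`c_w(φ ψ) = Σ_{w = u v} c_u(φ) c_v(ψ)`. [cite: Furusho2011, §2] -/
instance instMul : Mul (NCSeries α R) := ⟨fun φ ψ w => ∑ p ∈ splits w, φ p.1 * ψ p.2⟩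

/-- `c_w(φ ψ) = Σ_{(u,v) ∈ splits w} c_u(φ) c_v(ψ)`. [folklore] -/
theorem mul_apply (φ ψ : NCSeries α R) (w : List α) :
    (φ * ψ) w = ∑ p ∈ splits w, φ p.1 * ψ p.2 := rfl

/-- `c_w(C r · φ) = r c_w(φ)`. [folklore] -/
@[simp] theorem C_mul_apply (r : R) (φ : NCSeries α R) (w : List α) :
    ((C r : NCSeries α R) * φ) w = r * φ w := by
  rw [mul_apply, Finset.sum_eq_single_of_mem ([], w) (nil_self_mem_splits w)]
  · simp
  · rintro ⟨u, v⟩ hp hne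
    rw [mem_splits] at hp
    cases u with
    | nil => simp only [List.nil_append] at hp; subst hp; exact absurd rfl hne
    | cons a u => simp

/-- `c_w(φ · C r) = c_w(φ) r`. [folklore] -/
@[simp] theorem mul_C_apply (r : R) (φ : NCSeries α R) (w : List α) :
    (φ * (C r : NCSeries α R)) w = φ w * r := by
  rw [mul_apply, Finset.sum_eq_single_of_mem (w, []) (self_nil_mem_splits w)]
  · simp
  · rintro ⟨u, v⟩ hp hne
    rw [mem_splits] at hp
    cases v with
    | nil => simp only [List.append_nil] at hp; subst hp; exact absurd rfl hne
    | cons a v => simp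

/-- `1 · φ = φ`. [folklore] -/
protected theorem one_mul (φ : NCSeries α R) : (1 : NCSeries α R) * φ = φ := by
  ext w; rw [← C_one, C_mul_apply, one_mul]

/-- `φ · 1 = φ`. [folklore] -/
protected theorem mul_one (φ : NCSeries α R) : φ * (1 : NCSeries α R) = φ := by
  ext w; rw [← C_one, mul_C_apply, mul_one]

/-- The Cauchy product is associative (both sides are `Σ_{w = u v z} c_u c_v c_z`). [folklore] -/
protected theorem mul_assoc (φ₁ φ₂ φ₃ : NCSeries α R) : φ₁ * φ₂ * φ₃ = φ₁ * (φ₂ * φ₃) := by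
  ext w
  simp only [mul_apply, Finset.sum_mul, Finset.mul_sum, Finset.sum_sigma']
  apply Finset.sum_nbij' (fun ⟨⟨_i, j⟩, ⟨k, l⟩⟩ => ⟨(k, l ++ j), (l, j)⟩)
    (fun ⟨⟨i, _j⟩, ⟨k, l⟩⟩ => ⟨(i ++ k, l), (i, k)⟩) <;>
    aesop (add simp [List.append_assoc, mul_assoc])

/-- `0 · φ = 0`. [folklore] -/
protected theorem zero_mul (φ : NCSeries α R) : (0 : NCSeries α R) * φ = 0 := by
  ext w; simp [mul_apply]

/-- `φ · 0 = 0`. [folklore] -/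
protected theorem mul_zero (φ : NCSeries α R) : φ * (0 : NCSeries α R) = 0 := by
  ext w; simp [mul_apply]

/-- Left distributivity. [folklore] -/
protected theorem mul_add (φ₁ φ₂ φ₃ : NCSeries α R) : φ₁ * (φ₂ + φ₃) = φ₁ * φ₂ + φ₁ * φ₃ := by
  ext w; simp only [mul_apply, add_apply, mul_add, Finset.sum_add_distrib]

/-- Right distributivity. [folklore] -/
protected theorem add_mul (φ₁ φ₂ φ₃ : NCSeries α R) : (φ₁ + φ₂) * φ₃ = φ₁ * φ₃ + φ₂ * φ₃ := by
  ext w; simp only [mul_apply, add_apply, add_mul, Finset.sum_add_distrib]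

/-- `R⟨⟨α⟩⟩` is a semiring for the Cauchy product (natural numbers embed as constant series).
[folklore] -/
instance instSemiring : Semiring (NCSeries α R) where
  __ := (inferInstance : AddCommMonoid (NCSeries α R))
  natCast n := C n
  natCast_zero := by simp
  natCast_succ n := by simp [C_add]
  zero_mul := NCSeries.zero_mul
  mul_zero := NCSeries.mul_zero
  one_mul := NCSeries.one_mul
  mul_one := NCSeries.mul_one
  mul_assoc := NCSeries.mul_assoc
  left_distrib := NCSeries.mul_add
  right_distrib := NCSeries.add_mul

/-- A natural number `n` is the constant series `C n`. [folklore] -/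
theorem natCast_eq_C (n : ℕ) : ((n : NCSeries α R)) = C (n : R) := rfl

/-- `c_∅(n) = n`. [folklore] -/
@[simp] theorem natCast_apply_nil (n : ℕ) : (n : NCSeries α R) [] = n := rfl

/-- `c_{a w}(n) = 0`. [folklore] -/
@[simp] theorem natCast_apply_cons (n : ℕ) (a : α) (w : List α) : (n : NCSeries α R) (a :: w) = 0 :=
  rfl

/-- The constants `C : R → R⟨⟨α⟩⟩` form a ring homomorphism. [folklore] -/
def CHom : R →+* NCSeries α R where
  toFun := C
  map_one' := rfl
  map_mul' r s := by ext w; rw [C_mul_apply]; cases w <;> simp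
  map_zero' := C_zero
  map_add' := C_add

/-- `CHom r = C r`. [folklore] -/
@[simp] theorem CHom_apply (r : R) : (CHom r : NCSeries α R) = C r := rfl

end Semiring

/-- `R⟨⟨α⟩⟩` is a ring when `R` is. [folklore] -/
instance instRing [Ring R] : Ring (NCSeries α R) where
  __ := (inferInstance : Semiring (NCSeries α R))
  __ := (inferInstance : AddCommGroup (NCSeries α R))
  intCast n := C n
  intCast_ofNat n := by ext w; cases w <;> simp
  intCast_negSucc n := by ext w; cases w <;> simp

/-- `R⟨⟨α⟩⟩` is an `R`-algebra over a commutative `R` (constants are central: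
`c_w(C r · φ) = r c_w(φ) = c_w(φ) r = c_w(φ · C r)`). [folklore] -/
instance instAlgebra [CommSemiring R] : Algebra R (NCSeries α R) where
  algebraMap := CHom
  commutes' r φ := by ext w; simp [mul_comm]
  smul_def' r φ := by ext w; simp

/-- `algebraMap R R⟨⟨α⟩⟩ r = C r`. [folklore] -/
@[simp] theorem algebraMap_apply [CommSemiring R] (r : R) :
    algebraMap R (NCSeries α R) r = C r := rfl

section Monomial

variable [Semiring R] [DecidableEq α]

/-- The series `r · w` with the single coefficient `r` on the word `w`. [folklore] -/
def monomial (w : List α) (r : R) : NCSeries α R := Pi.single w r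

/-- `c_u(r · w) = r` if `u = w`, and `0` otherwise. [folklore] -/
@[simp] theorem monomial_apply (w u : List α) (r : R) :
    monomial w r u = if u = w then r else 0 := by
  simp [monomial, Pi.single_apply]

/-- The **letter** `a` as a series (the generator `X_a` of `R⟨⟨α⟩⟩`). [folklore] -/
def letter (a : α) : NCSeries α R := monomial [a] 1

/-- `c_u(X_a) = 1` if `u = a`, and `0` otherwise. [folklore] -/
@[simp] theorem letter_apply (a : α) (u : List α) :
    (letter a : NCSeries α R) u = if u = [a] then 1 else 0 := monomial_apply _ _ _

/-- `(r · u) (s · v) = (r s) · (u v)`: monomials multiply by concatenation. [folklore] -/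
theorem monomial_mul_monomial (u v : List α) (r s : R) :
    monomial u r * monomial v s = (monomial (u ++ v) (r * s) : NCSeries α R) := by
  ext w
  rw [mul_apply, monomial_apply]
  split_ifs with h
  · subst h
    rw [Finset.sum_eq_single_of_mem (u, v) (mem_splits.mpr rfl)]
    · simp
    · rintro ⟨u', v'⟩ hp hne
      rw [mem_splits] at hp
      by_cases hu : u' = u
      · subst hu
        have hv : v' = v := List.append_cancel_left hp
        subst hv
        exact absurd rfl hne
      · simp [hu]
  · refine Finset.sum_eq_zero ?_
    rintro ⟨u', v'⟩ hp
    rw [mem_splits] at hp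
    by_cases hu : u' = u
    · subst hu
      have hv : v' ≠ v := by rintro rfl; exact h hp.symm
      simp [hv]
    · simp [hu]

end Monomial

/-- Furusho's variable `X₀` of `U𝔉₂ = R⟨⟨X₀, X₁⟩⟩ = NCSeries Bool R`: the letter `false`
(= the letter `0` of the tree's binary words `MZV.binaryWord`, the form `ω₀ = dt/t`).
[cite: Furusho2011, §2] -/
abbrev X₀ [Semiring R] : NCSeries Bool R := letter false

/-- Furusho's variable `X₁` of `U𝔉₂ = R⟨⟨X₀, X₁⟩⟩ = NCSeries Bool R`: the letter `true`
(= the letter `1` of the tree's binary words, the form `ω₁ = dt/(1-t)`). [cite: Furusho2011, §2] -/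
abbrev X₁ [Semiring R] : NCSeries Bool R := letter true

section Map

variable {S : Type*} [Semiring R] [Semiring S]

/-- Change of coefficients along a ring homomorphism `f : R → S` (the `S`-point of a series under
base change): `c_w(map f φ) = f(c_w(φ))`, a ring homomorphism `R⟨⟨α⟩⟩ → S⟨⟨α⟩⟩`. [folklore] -/
def map (f : R →+* S) : NCSeries α R →+* NCSeries α S where
  toFun φ := fun w => f (φ w)
  map_one' := by ext w; cases w <;> simp
  map_mul' φ ψ := by ext w; simp [mul_apply, map_sum]
  map_zero' := by ext w; simp
  map_add' φ ψ := by ext w; simp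

/-- `c_w(map f φ) = f(c_w(φ))`. [folklore] -/
@[simp] theorem map_apply (f : R →+* S) (φ : NCSeries α R) (w : List α) : map f φ w = f (φ w) :=
  rfl

end Map

section Weight

variable [Semiring R]

/-- **Weight truncation**: kill all words of length (weight) `> N`. Two series agree modulo weight
`> N` iff their truncations agree. [folklore] -/
def trunc (N : ℕ) (φ : NCSeries α R) : NCSeries α R := fun w => if w.length ≤ N then φ w else 0

/-- `c_w(trunc N φ) = c_w(φ)` for `|w| ≤ N`, else `0`. [folklore] -/
@[simp] theorem trunc_apply (N : ℕ) (φ : NCSeries α R) (w : List α) :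
    trunc N φ w = if w.length ≤ N then φ w else 0 := rfl

end Weight

section Eval

variable [CommSemiring R] {A : Type*} [Semiring A] [Algebra R A] [Fintype α]

/-- **Weight-truncated substitution of letters**: for `v : α → A` into an `R`-algebra `A`,
`evalTrunc N v φ = Σ_{|w| ≤ N} c_w(φ) · v(w₁) ⋯ v(w_n)` — the image of the weight-`≤ N` part of
`φ` under the algebra map `X_a ↦ v a`. When every product of `N + 1` values of `v` vanishes in `A`
(as in the truncated Drinfeld–Kohno algebras below) this is Furusho's `φ(v(X₀), v(X₁))`, the image
of the whole series. Words of length `n` are enumerated as `List.ofFn f`, `f : Fin n → α`.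
[cite: Furusho2011, §2] -/
def evalTrunc (N : ℕ) (v : α → A) (φ : NCSeries α R) : A :=
  ∑ n ∈ Finset.range (N + 1), ∑ f : Fin n → α, φ (List.ofFn f) • ((List.ofFn f).map v).prod

/-- `evalTrunc` is additive in the series. [folklore] -/
theorem evalTrunc_add (N : ℕ) (v : α → A) (φ ψ : NCSeries α R) :
    evalTrunc N v (φ + ψ) = evalTrunc N v φ + evalTrunc N v ψ := by
  simp [evalTrunc, add_smul, Finset.sum_add_distrib]

/-- The substitution of the unit series is `1` (only the empty word contributes). [folklore] -/
@[simp] theorem evalTrunc_one (N : ℕ) (v : α → A) : evalTrunc N v (1 : NCSeries α R) = 1 := by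
  unfold evalTrunc
  rw [Finset.sum_eq_single_of_mem 0 (by simp) ?_]
  · rw [Fintype.sum_unique, List.ofFn_zero, one_apply_nil, one_smul, List.map_nil, List.prod_nil]
  · intro n _ hn
    obtain ⟨k, rfl⟩ := Nat.exists_eq_succ_of_ne_zero hn
    refine Finset.sum_eq_zero fun f _ => ?_
    rw [List.ofFn_succ, one_apply_cons, zero_smul]

/-- The substitution of a constant series is that constant. [folklore] -/
@[simp] theorem evalTrunc_C (N : ℕ) (v : α → A) (r : R) :
    evalTrunc N v (C r : NCSeries α R) = algebraMap R A r := by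
  unfold evalTrunc
  rw [Finset.sum_eq_single_of_mem 0 (by simp) ?_]
  · simp [Algebra.algebraMap_eq_smul_one]
  · intro n _ hn
    obtain ⟨k, rfl⟩ := Nat.exists_eq_succ_of_ne_zero hn
    refine Finset.sum_eq_zero fun f _ => ?_
    simp [List.ofFn_succ]

/-- Substitution commutes with base change: for a map of algebras `F : A → B` over `f : R → S`
(`F (r • a) = f r • F a`), `F(φ(v)) = (map f φ)(F ∘ v)` weight by weight. [folklore] -/
theorem ringHom_evalTrunc {S : Type*} [CommSemiring S] {B : Type*} [Semiring B] [Algebra S B]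
    (F : A →+* B) (f : R →+* S) (hF : ∀ (r : R) (a : A), F (r • a) = f r • F a) (N : ℕ)
    (v : α → A) (φ : NCSeries α R) :
    F (evalTrunc N v φ) = evalTrunc N (F ∘ v) (map f φ) := by
  simp [evalTrunc, map_sum, hF, map_list_prod, Function.comp_def]

end Eval

section BSub

variable {A : Type*}

/-- The substitution `X₀ ↦ a`, `X₁ ↦ b` of the two letters of `Bool` (`false ↦ a`, `true ↦ b`).
[folklore] -/
def bsub (a b : A) : Bool → A := fun c => cond c b a

/-- `bsub a b false = a`. [folklore] -/
@[simp] theorem bsub_false (a b : A) : bsub a b false = a := rfl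

/-- `bsub a b true = b`. [folklore] -/
@[simp] theorem bsub_true (a b : A) : bsub a b true = b := rfl

end BSub

section Support

variable [Semiring R]

/-- A product `S T` vanishes on a word `w` as soon as `S` and `T` vanish on all words containing a
letter satisfying `p` and `w` contains such a letter (every cut of `w` puts that letter in one of
the two factors). [folklore] -/
theorem mul_apply_eq_zero_of_mem {p : α → Prop} {S T : NCSeries α R}
    (hS : ∀ w, (∃ a ∈ w, p a) → S w = 0) (hT : ∀ w, (∃ a ∈ w, p a) → T w = 0) {w : List α}
    (hw : ∃ a ∈ w, p a) : (S * T) w = 0 := by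
  rw [mul_apply]
  refine Finset.sum_eq_zero ?_
  rintro ⟨u, v⟩ huv
  rw [mem_splits] at huv
  obtain ⟨a, ha, hpa⟩ := hw
  rw [← huv, List.mem_append] at ha
  rcases ha with ha | ha
  · simp [hS u ⟨a, ha, hpa⟩]
  · simp [hT v ⟨a, ha, hpa⟩]

/-- All powers `Sᵐ` of a series `S` vanishing on the words containing a letter satisfying `p`
vanish on these words too (for `m = 0` such a word is non-empty, so `c_w(1) = 0`). [folklore] -/
theorem pow_apply_eq_zero_of_mem {p : α → Prop} {S : NCSeries α R}
    (hS : ∀ w, (∃ a ∈ w, p a) → S w = 0) :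
    ∀ (m : ℕ) (w : List α), (∃ a ∈ w, p a) → (S ^ m) w = 0
  | 0, [], hw => by simp at hw
  | 0, a :: w, _ => by simp
  | m + 1, w, hw => by
    rw [pow_succ]
    exact mul_apply_eq_zero_of_mem (pow_apply_eq_zero_of_mem hS m) hS hw

end Support

section Exp

variable [CommRing R] [Algebra ℚ R]

/-- The **exponential** of a series `S` WITHOUT constant term over a `ℚ`-algebra:
`exp S = Σ_{m ≥ 0} Sᵐ/m!`, computed coefficientwise as the finite sum
`c_w(exp S) = Σ_{m ≤ |w|} c_w(Sᵐ)/m!` (for `c_∅(S) = 0` the power `Sᵐ` has no word of length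
`< m`). On series with non-zero constant term the value is a junk truncation. [folklore] -/
def exp (S : NCSeries α R) : NCSeries α R := fun w =>
  ∑ m ∈ Finset.range (w.length + 1), algebraMap ℚ R (1 / (m.factorial : ℚ)) * (S ^ m) w

/-- `exp 0 = 1`. [folklore] -/
@[simp] theorem exp_zero : exp (0 : NCSeries α R) = 1 := by
  ext w
  unfold exp
  rw [Finset.sum_eq_single_of_mem 0 (by simp) ?_]
  · simp
  · intro m _ hm
    simp [zero_pow hm]

/-- `exp S` vanishes on every word containing a letter satisfying `p` when `S` vanishes on all
such words. [folklore] -/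
theorem exp_apply_eq_zero_of_mem {p : α → Prop} {S : NCSeries α R}
    (hS : ∀ w, (∃ a ∈ w, p a) → S w = 0) {w : List α} (hw : ∃ a ∈ w, p a) : exp S w = 0 := by
  unfold exp
  exact Finset.sum_eq_zero fun m _ => by rw [pow_apply_eq_zero_of_mem hS m w hw, mul_zero]

/-- `exp S` has constant term `1`. [folklore] -/
@[simp] theorem exp_apply_nil (S : NCSeries α R) : exp S [] = 1 := by
  simp [exp]

end Exp

/-! ## 2. Group-like series -/

section GroupLike

variable [Semiring R]

/-- A series `φ ∈ R⟨⟨α⟩⟩` is **group-like**: its constant term is `1` and `Δ φ = φ ⊗̂ φ` for the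
(completed) coproduct with `Δ(x) = x ⊗ 1 + 1 ⊗ x` on letters `x` (Furusho 2011, §2). As
`⟨Δ φ, u ⊗ v⟩ = Σ_w ⟨u ш v, w⟩ c_w(φ)` (`Δ` is the transpose of the shuffle product `ш`:
Racinet 2002, §2, after Prop. 2.8, referring to Reutenauer 1993) and
`⟨φ ⊗̂ φ, u ⊗ v⟩ = c_u(φ) c_v(φ)`, the condition reads, and is recorded as, the **shuffle
relations** `c_u(φ) c_v(φ) = Σ_{w ∈ u ш v} c_w(φ)` for all words `u, v` (shuffles listed with
multiplicity by `MZV.shuffleWord`; Ree's theorem). For `φ = Φ_KZ` these are the (regularised)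
shuffle relations of multiple zeta values. [cite: Furusho2011, §2] -/
def IsGroupLike (φ : NCSeries α R) : Prop :=
  φ [] = 1 ∧ ∀ u v : List α, φ u * φ v = ((MZV.shuffleWord u v).map φ).sum

/-- A group-like series has constant term `1`. [folklore] -/
theorem IsGroupLike.apply_nil {φ : NCSeries α R} (h : IsGroupLike φ) : φ [] = 1 := h.1

/-- The shuffle relations of a group-like series. [folklore] -/
theorem IsGroupLike.mul_eq_sum_shuffleWord {φ : NCSeries α R} (h : IsGroupLike φ) (u v : List α) :
    φ u * φ v = ((MZV.shuffleWord u v).map φ).sum := h.2 u v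

/-- In weight `(1,1)`: `c_a(φ) c_b(φ) = c_{ab}(φ) + c_{ba}(φ)` for a group-like `φ`; e.g.
`c_{X₀}c_{X₁} = c_{X₀X₁} + c_{X₁X₀}`. [folklore] -/
theorem IsGroupLike.apply_singleton_mul {φ : NCSeries α R} (h : IsGroupLike φ) (a b : α) :
    φ [a] * φ [b] = φ [a, b] + φ [b, a] := by
  simpa using h.2 [a] [b]

/-- The unit series `1` is group-like (the trivial solution). [folklore] -/
theorem isGroupLike_one : IsGroupLike (1 : NCSeries α R) := by
  refine ⟨rfl, fun u v => ?_⟩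
  cases u with
  | nil => simp
  | cons a u =>
    cases v with
    | nil => simp
    | cons b v =>
      simp only [one_apply_cons, zero_mul, MZV.shuffleWord_cons_cons, List.map_append,
        List.map_map, List.sum_append]
      simp [Function.comp_def]

/-- Group-likeness is preserved by change of coefficients. [folklore] -/
theorem IsGroupLike.map {S : Type*} [Semiring S] {φ : NCSeries α R} (h : IsGroupLike φ)
    (f : R →+* S) : IsGroupLike (NCSeries.map f φ) := by
  refine ⟨by simp [h.1], fun u v => ?_⟩
  simp only [map_apply, ← map_mul, h.2 u v, map_list_sum, List.map_map]
  rfl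

end GroupLike

end NCSeries

/-! ## 3. Truncated Drinfeld–Kohno algebras -/

namespace DrinfeldKohno

variable (R : Type u) [CommRing R] (ι : Type v) (N : ℕ)

/-- The defining relations of the **weight-truncated Drinfeld–Kohno algebra** on strands `ι`, on
the free algebra with generators `FreeAlgebra.ι R (i, j)` (`i j : ι`, standing for `t_ij`):
Furusho's presentation of the pure braid Lie algebra — `t_ii = 0`, `t_ij = t_ji`, the
infinitesimal braid (4T) relations
`t_ij (t_ik + t_jk) = (t_ik + t_jk) t_ij` for `i, j, k` distinct, locality
`t_ij t_kl = t_kl t_ij` for `i, j, k, l` distinct [Furusho2011, §2] — together with the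
TRUNCATION: every product of `N + 1` generators is `0`. [cite: Furusho2011, §2] -/
inductive Rel : FreeAlgebra R (ι × ι) → FreeAlgebra R (ι × ι) → Prop
  | diag (i : ι) : Rel (FreeAlgebra.ι R (i, i)) 0
  | symm (i j : ι) : Rel (FreeAlgebra.ι R (i, j)) (FreeAlgebra.ι R (j, i))
  | fourTerm (i j k : ι) : i ≠ j → j ≠ k → i ≠ k →
      Rel (FreeAlgebra.ι R (i, j) * (FreeAlgebra.ι R (i, k) + FreeAlgebra.ι R (j, k)))
        ((FreeAlgebra.ι R (i, k) + FreeAlgebra.ι R (j, k)) * FreeAlgebra.ι R (i, j))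
  | locality (i j k l : ι) : i ≠ j → i ≠ k → i ≠ l → j ≠ k → j ≠ l → k ≠ l →
      Rel (FreeAlgebra.ι R (i, j) * FreeAlgebra.ι R (k, l))
        (FreeAlgebra.ι R (k, l) * FreeAlgebra.ι R (i, j))
  | trunc (g : Fin (N + 1) → ι × ι) : Rel (List.ofFn fun r => FreeAlgebra.ι R (g r)).prod 0

end DrinfeldKohno

/-- The **weight-truncated Drinfeld–Kohno algebra** `U𝔞_ι ⊗ R / (weight > N)`: the free
`R`-algebra on generators `t i j` (`i j : ι`) modulo `t_ii = 0`, `t_ij = t_ji`,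
`[t_ij, t_ik + t_jk] = 0` (`i,j,k` distinct), `[t_ij, t_kl] = 0` (`i,j,k,l` distinct) and all
products of `N + 1` generators (`DrinfeldKohno.Rel`). For `ι = Fin 4` this is the quotient of
(the enveloping algebra of) Furusho's `𝔞₄`, the completed pure braid Lie algebra on 4 strands, by
weight `> N`; the completion `U𝔞₄^∧ ⊗̂ R` is the inverse limit over `N`, and identities there are
stated truncation by truncation. [cite: Furusho2011, §2] -/
def DrinfeldKohnoTrunc (R : Type u) [CommRing R] (ι : Type v) (N : ℕ) : Type (max u v) :=
  RingQuot (DrinfeldKohno.Rel R ι N)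

namespace DrinfeldKohnoTrunc

variable {R : Type u} [CommRing R] {ι : Type v} {N : ℕ}

/-- The truncated Drinfeld–Kohno algebra is a ring (quotient structure). [folklore] -/
instance instRing : Ring (DrinfeldKohnoTrunc R ι N) :=
  inferInstanceAs (Ring (RingQuot (DrinfeldKohno.Rel R ι N)))

/-- The truncated Drinfeld–Kohno algebra is an `R`-algebra (quotient structure). [folklore] -/
instance instAlgebra : Algebra R (DrinfeldKohnoTrunc R ι N) :=
  inferInstanceAs (Algebra R (RingQuot (DrinfeldKohno.Rel R ι N)))

/-- The truncated Drinfeld–Kohno algebra is inhabited (by `0`). [folklore] -/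
instance instInhabited : Inhabited (DrinfeldKohnoTrunc R ι N) := ⟨0⟩

variable (R N) in
/-- The quotient map from the free algebra on the symbols `(i, j)`. [folklore] -/
def mk : FreeAlgebra R (ι × ι) →ₐ[R] DrinfeldKohnoTrunc R ι N :=
  RingQuot.mkAlgHom R (DrinfeldKohno.Rel R ι N)

variable (R N) in
/-- The generator `t i j` (Furusho's `t_ij`, `1 ≤ i, j ≤ 4`, here `i j : ι`). [cite: Furusho2011, §2] -/
def t (i j : ι) : DrinfeldKohnoTrunc R ι N := mk R N (FreeAlgebra.ι R (i, j))

/-- Related elements of the free algebra have the same class. [folklore] -/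
theorem mk_rel {a b : FreeAlgebra R (ι × ι)} (h : DrinfeldKohno.Rel R ι N a b) :
    mk R N a = mk R N b :=
  RingQuot.mkAlgHom_rel R h

/-- `t_ii = 0`. [cite: Furusho2011, §2] -/
@[simp] theorem t_self (i : ι) : t R N i i = 0 := by
  simpa [t] using mk_rel (DrinfeldKohno.Rel.diag (R := R) (ι := ι) (N := N) i)

/-- `t_ij = t_ji`. [cite: Furusho2011, §2] -/
theorem t_symm (i j : ι) : t R N i j = t R N j i :=
  mk_rel (DrinfeldKohno.Rel.symm (R := R) (N := N) i j)

/-- The infinitesimal braid relation `[t_ij, t_ik + t_jk] = 0` for `i, j, k` distinct, in the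
form `t_ij (t_ik + t_jk) = (t_ik + t_jk) t_ij`. [cite: Furusho2011, §2] -/
theorem t_mul_add (i j k : ι) (hij : i ≠ j) (hjk : j ≠ k) (hik : i ≠ k) :
    t R N i j * (t R N i k + t R N j k) = (t R N i k + t R N j k) * t R N i j := by
  simpa [t] using mk_rel (DrinfeldKohno.Rel.fourTerm (R := R) (N := N) i j k hij hjk hik)

/-- Locality `[t_ij, t_kl] = 0` for `i, j, k, l` distinct. [cite: Furusho2011, §2] -/
theorem t_comm (i j k l : ι) (hij : i ≠ j) (hik : i ≠ k) (hil : i ≠ l) (hjk : j ≠ k) (hjl : j ≠ l)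
    (hkl : k ≠ l) : t R N i j * t R N k l = t R N k l * t R N i j := by
  simpa [t] using
    mk_rel (DrinfeldKohno.Rel.locality (R := R) (N := N) i j k l hij hik hil hjk hjl hkl)

/-- Truncation: every product of `N + 1` generators vanishes. [folklore] -/
theorem prod_t_eq_zero (g : Fin (N + 1) → ι × ι) :
    (List.ofFn fun r => t R N (g r).1 (g r).2).prod = 0 := by
  have h := mk_rel (DrinfeldKohno.Rel.trunc (R := R) (ι := ι) (N := N) g)
  rw [map_list_prod, map_zero, List.map_ofFn] at h
  simpa [t, Function.comp_def] using h

/-- In particular the generators are nilpotent: `t_ij ^ (N + 1) = 0`. [folklore] -/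
theorem t_pow_eq_zero (i j : ι) : t R N i j ^ (N + 1) = 0 := by
  have h := prod_t_eq_zero (R := R) (N := N) (fun _ : Fin (N + 1) => (i, j))
  rwa [List.ofFn_const, List.prod_replicate] at h

/-- The truncated exponential `Σ_{m ≤ N} xᵐ/m!` in the truncated algebra over a `ℚ`-algebra `R`;
it is the exponential of every `x` with `x^{N+1} = 0`, e.g. of the `R`-multiples of the `t_ij` and
of their sums of weight `≥ 1` (used in the hexagon equations `exp{μ t_ij/2}`). [folklore] -/
def expT [Algebra ℚ R] (x : DrinfeldKohnoTrunc R ι N) : DrinfeldKohnoTrunc R ι N :=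
  ∑ m ∈ Finset.range (N + 1), algebraMap ℚ R (1 / (m.factorial : ℚ)) • x ^ m

/-- `expT 0 = 1`. [folklore] -/
@[simp] theorem expT_zero [Algebra ℚ R] : expT (0 : DrinfeldKohnoTrunc R ι N) = 1 := by
  unfold expT
  rw [Finset.sum_eq_single_of_mem 0 (by simp) ?_]
  · simp
  · intro m _ hm
    simp [zero_pow hm]

/-! ### Base change -/

section BaseChange

variable {S : Type*} [CommRing S]

/-- Auxiliary ring map `FreeAlgebra R (ι × ι) → DrinfeldKohnoTrunc S ι N` over `f : R → S`:
scalars through `f`, the symbol `(i, j)` to `t i j`. [folklore] -/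
def mapAux (f : R →+* S) : FreeAlgebra R (ι × ι) →+* DrinfeldKohnoTrunc S ι N :=
  letI : Algebra R (DrinfeldKohnoTrunc S ι N) :=
    ((algebraMap S (DrinfeldKohnoTrunc S ι N)).comp f).toAlgebra' fun c x => Algebra.commutes (f c) x
  (FreeAlgebra.lift R fun p : ι × ι => t S N p.1 p.2).toRingHom

/-- `mapAux f` sends the symbol `(i, j)` to `t i j`. [folklore] -/
@[simp] theorem mapAux_ι (f : R →+* S) (p : ι × ι) :
    mapAux (N := N) f (FreeAlgebra.ι R p) = t S N p.1 p.2 := by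
  letI : Algebra R (DrinfeldKohnoTrunc S ι N) :=
    ((algebraMap S (DrinfeldKohnoTrunc S ι N)).comp f).toAlgebra' fun c x => Algebra.commutes (f c) x
  exact FreeAlgebra.lift_ι_apply _ _

/-- `mapAux f` sends the scalar `r` to the scalar `f r`. [folklore] -/
@[simp] theorem mapAux_algebraMap (f : R →+* S) (r : R) :
    mapAux (N := N) f (algebraMap R (FreeAlgebra R (ι × ι)) r) =
      algebraMap S (DrinfeldKohnoTrunc S ι N) (f r) := by
  letI : Algebra R (DrinfeldKohnoTrunc S ι N) :=
    ((algebraMap S (DrinfeldKohnoTrunc S ι N)).comp f).toAlgebra' fun c x => Algebra.commutes (f c) x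
  exact (FreeAlgebra.lift R fun p : ι × ι => t S N p.1 p.2).commutes r

/-- `mapAux f` respects the defining relations (each relation over `R` maps to the same relation
over `S`). [folklore] -/
theorem mapAux_rel (f : R →+* S) {a b : FreeAlgebra R (ι × ι)} (h : DrinfeldKohno.Rel R ι N a b) :
    mapAux (N := N) f a = mapAux f b := by
  cases h with
  | diag i => simp
  | symm i j => simpa using t_symm (R := S) (N := N) i j
  | fourTerm i j k hij hjk hik =>
    simpa [map_mul, map_add] using t_mul_add (R := S) (N := N) i j k hij hjk hik
  | locality i j k l hij hik hil hjk hjl hkl =>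
    simpa [map_mul] using t_comm (R := S) (N := N) i j k l hij hik hil hjk hjl hkl
  | trunc g =>
    rw [map_list_prod, map_zero, List.map_ofFn]
    simpa [Function.comp_def] using prod_t_eq_zero (R := S) (N := N) g

/-- **Base change** of the truncated Drinfeld–Kohno algebra along a ring map `f : R → S`
(`U𝔞 ⊗ R → U𝔞 ⊗ S`): `t i j ↦ t i j`, scalars through `f`. [folklore] -/
def map (f : R →+* S) : DrinfeldKohnoTrunc R ι N →+* DrinfeldKohnoTrunc S ι N :=
  RingQuot.lift ⟨mapAux f, fun _ _ h => mapAux_rel f h⟩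

/-- `map f` on classes is `mapAux f`. [folklore] -/
theorem map_mk (f : R →+* S) (a : FreeAlgebra R (ι × ι)) : map f (mk R N a) = mapAux f a := by
  have h1 : mk R N a = RingQuot.mkRingHom (DrinfeldKohno.Rel R ι N) a :=
    congrArg (fun g : FreeAlgebra R (ι × ι) →+* RingQuot (DrinfeldKohno.Rel R ι N) => g a)
      (RingQuot.mkAlgHom_coe R (DrinfeldKohno.Rel R ι N))
  rw [h1]
  exact RingQuot.lift_mkRingHom_apply (mapAux f) (fun _ _ h => mapAux_rel f h) a

/-- `map f (t i j) = t i j`. [folklore] -/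
@[simp] theorem map_t (f : R →+* S) (i j : ι) : map f (t R N i j) = t S N i j := by
  rw [t, map_mk, mapAux_ι]

/-- `map f` sends the scalar `r` to the scalar `f r`. [folklore] -/
@[simp] theorem map_algebraMap (f : R →+* S) (r : R) :
    map f (algebraMap R (DrinfeldKohnoTrunc R ι N) r) =
      algebraMap S (DrinfeldKohnoTrunc S ι N) (f r) := by
  rw [← (mk R N).commutes r, map_mk, mapAux_algebraMap]

/-- `map f` is `f`-semilinear: `map f (r • x) = f r • map f x`. [folklore] -/
theorem map_smul (f : R →+* S) (r : R) (x : DrinfeldKohnoTrunc R ι N) :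
    map f (r • x) = f r • map f x := by
  rw [Algebra.smul_def, map_mul, map_algebraMap, ← Algebra.smul_def]

/-- `map f` commutes with the truncated exponentials (for `ℚ`-algebras `R`, `S`). [folklore] -/
theorem map_expT [Algebra ℚ R] [Algebra ℚ S] (f : R →+* S) (x : DrinfeldKohnoTrunc R ι N) :
    map f (expT x) = expT (map f x) := by
  have hq : ∀ q : ℚ, f (algebraMap ℚ R q) = algebraMap ℚ S q := fun q =>
    RingHom.congr_fun (Subsingleton.elim (f.comp (algebraMap ℚ R)) (algebraMap ℚ S)) q
  simp [expT, map_sum, map_smul, hq]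

end BaseChange

end DrinfeldKohnoTrunc


/-! ## 4. The pentagon and hexagon equations -/

namespace NCSeries

section GT

variable {R : Type v} [CommRing R]

/-- Furusho's `φ(a, b)`: the image of `φ ∈ R⟨⟨X₀, X₁⟩⟩` under the algebra map `X₀ ↦ a`,
`X₁ ↦ b` into an `R`-algebra in which words of weight `> N` vanish (`NCSeries.evalTrunc` with
the substitution `NCSeries.bsub a b`). [cite: Furusho2011, §2] -/
abbrev subst₂ {A : Type*} [Ring A] [Algebra R A] (N : ℕ) (φ : NCSeries Bool R) (a b : A) : A :=
  evalTrunc N (bsub a b) φ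

variable (R) in
/-- The generator `t_ij` of the weight-`≤ N` truncation of `U𝔞₄ ⊗ R`, strands indexed by
`Fin 4 = {0,1,2,3}` (the paper's strand `i` is `i - 1` here). [cite: Furusho2011, §2] -/
abbrev t₄ (N : ℕ) (i j : Fin 4) : DrinfeldKohnoTrunc R (Fin 4) N := DrinfeldKohnoTrunc.t R N i j

/-- **Drinfeld's pentagon equation** for `φ ∈ R⟨⟨X₀, X₁⟩⟩` [Furusho2011, §2, (pentagon)]:
`φ(t₁₂, t₂₃ + t₂₄) φ(t₁₃ + t₂₃, t₃₄) = φ(t₂₃, t₃₄) φ(t₁₂ + t₁₃, t₂₄ + t₃₄) φ(t₁₂, t₂₃)`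
in `U𝔞₄^∧ ⊗̂ R`, stated as the family of its images in all weight truncations
`DrinfeldKohnoTrunc R (Fin 4) N` (strands `1,2,3,4` ↦ `0,1,2,3`). Equivalent forms: the 5-cycle
relation in `U𝔓₅` [Furusho2011, Thm 2.1]; Drinfeld's original [Drinfeld1991].
[cite: Furusho2011, §2 (pentagon)] -/
def DrinfeldPentagon (φ : NCSeries Bool R) : Prop :=
  ∀ N : ℕ,
    subst₂ N φ (t₄ R N 0 1) (t₄ R N 1 2 + t₄ R N 1 3) *
        subst₂ N φ (t₄ R N 0 2 + t₄ R N 1 2) (t₄ R N 2 3) =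
      subst₂ N φ (t₄ R N 1 2) (t₄ R N 2 3) *
          subst₂ N φ (t₄ R N 0 1 + t₄ R N 0 2) (t₄ R N 1 3 + t₄ R N 2 3) *
        subst₂ N φ (t₄ R N 0 1) (t₄ R N 1 2)

/-- The unit series satisfies the pentagon (`1 · 1 = 1 · 1 · 1`). [folklore] -/
theorem drinfeldPentagon_one : DrinfeldPentagon (1 : NCSeries Bool R) := by
  intro N; simp [subst₂]

/-- `φ(a, b)` commutes with base change of the truncated Drinfeld–Kohno algebra. [folklore] -/
theorem map_subst₂ {S : Type*} [CommRing S] {ι : Type*} (f : R →+* S) (N : ℕ) (φ : NCSeries Bool R)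
    (a b : DrinfeldKohnoTrunc R ι N) :
    DrinfeldKohnoTrunc.map f (subst₂ N φ a b) =
      subst₂ N (map f φ) (DrinfeldKohnoTrunc.map f a) (DrinfeldKohnoTrunc.map f b) := by
  rw [subst₂, ringHom_evalTrunc (DrinfeldKohnoTrunc.map f) f (DrinfeldKohnoTrunc.map_smul f)]
  congr 1
  funext c
  cases c <;> rfl

/-- **The pentagon equation is preserved by change of coefficients** `f : R → S` (the `S`-point
of a pentagon solution is a pentagon solution). [folklore] -/
theorem DrinfeldPentagon.map {S : Type*} [CommRing S] {φ : NCSeries Bool R} (h : DrinfeldPentagon φ)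
    (f : R →+* S) : DrinfeldPentagon (NCSeries.map f φ) := by
  intro N
  have h' := congrArg (DrinfeldKohnoTrunc.map f) (h N)
  simpa only [map_mul, map_add, map_subst₂, t₄, DrinfeldKohnoTrunc.map_t] using h'

variable [Algebra ℚ R]

/-- **Drinfeld's first hexagon equation** for `(μ, φ)` [Furusho2011, §2, (hexagon)]:
`exp{μ(t₁₃ + t₂₃)/2} = φ(t₁₃, t₁₂) exp{μ t₁₃/2} φ(t₁₃, t₂₃)⁻¹ exp{μ t₂₃/2} φ(t₁₂, t₂₃)`
in `U𝔞₄^∧ ⊗̂ R` (`R` a `ℚ`-algebra), in all weight truncations (strands `1,2,3` ↦ `0,1,2`;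
`exp` = `DrinfeldKohnoTrunc.expT`, exact on these nilpotent arguments; the inverse is
`Ring.inverse`, the genuine inverse whenever `c_∅(φ)` is a unit, e.g. for group-like `φ`).
[cite: Furusho2011, §2 (hexagon)] -/
def DrinfeldHexagon (μ : R) (φ : NCSeries Bool R) : Prop :=
  ∀ N : ℕ,
    DrinfeldKohnoTrunc.expT (((1 / 2 : ℚ) • μ) • (t₄ R N 0 2 + t₄ R N 1 2)) =
      subst₂ N φ (t₄ R N 0 2) (t₄ R N 0 1) *
              DrinfeldKohnoTrunc.expT (((1 / 2 : ℚ) • μ) • t₄ R N 0 2) *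
            Ring.inverse (subst₂ N φ (t₄ R N 0 2) (t₄ R N 1 2)) *
          DrinfeldKohnoTrunc.expT (((1 / 2 : ℚ) • μ) • t₄ R N 1 2) *
        subst₂ N φ (t₄ R N 0 1) (t₄ R N 1 2)

/-- **Drinfeld's second hexagon equation** for `(μ, φ)` [Furusho2011, §2, (hexagon-b)]:
`exp{μ(t₁₂ + t₁₃)/2} = φ(t₂₃, t₁₃)⁻¹ exp{μ t₁₃/2} φ(t₁₂, t₁₃) exp{μ t₁₂/2} φ(t₁₂, t₂₃)⁻¹`,
in all weight truncations (conventions as in `NCSeries.DrinfeldHexagon`).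
[cite: Furusho2011, §2 (hexagon-b)] -/
def DrinfeldHexagonB (μ : R) (φ : NCSeries Bool R) : Prop :=
  ∀ N : ℕ,
    DrinfeldKohnoTrunc.expT (((1 / 2 : ℚ) • μ) • (t₄ R N 0 1 + t₄ R N 0 2)) =
      Ring.inverse (subst₂ N φ (t₄ R N 1 2) (t₄ R N 0 2)) *
              DrinfeldKohnoTrunc.expT (((1 / 2 : ℚ) • μ) • t₄ R N 0 2) *
            subst₂ N φ (t₄ R N 0 1) (t₄ R N 0 2) *
          DrinfeldKohnoTrunc.expT (((1 / 2 : ℚ) • μ) • t₄ R N 0 1) *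
        Ring.inverse (subst₂ N φ (t₄ R N 0 1) (t₄ R N 1 2))

/-- **Associators.** The pair `(μ, φ)` satisfies the GT-relations: `φ` is group-like and satisfies
the pentagon, and `(μ, φ)` satisfies the two hexagons — i.e. "`φ` is an associator with `μ`"
[Furusho2011, §1], a point of Drinfeld's associator set `M̲` ([Furusho2010, §1]; `M_μ` for
`μ ≠ 0`, and `GRT₁ = {φ | (0, φ) ∈ M̲}`). By [Furusho2010, Thm 1] (`furusho_pentagon_hexagon`)
the hexagons follow from the pentagon for `μ = ±(24 c_{X₀X₁}(φ))^{1/2} ∈ k̄`.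
[cite: Furusho2011, §1–§2] -/
def IsAssociatorPair (μ : R) (φ : NCSeries Bool R) : Prop :=
  IsGroupLike φ ∧ DrinfeldPentagon φ ∧ DrinfeldHexagon μ φ ∧ DrinfeldHexagonB μ φ

/-- The trivial associator: `(0, 1)` satisfies the GT-relations (`1 ∈ GRT₁`). [folklore] -/
theorem isAssociatorPair_zero_one : IsAssociatorPair (0 : R) (1 : NCSeries Bool R) := by
  refine ⟨isGroupLike_one, drinfeldPentagon_one, fun N => ?_, fun N => ?_⟩ <;> simp [subst₂]

end GT

/-! ## 5. Series shuffle regularisation and the generalised double shuffle relation -/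

section DoubleShuffle

variable {R : Type v} [CommRing R]

/-- Furusho's `k`-linear map `π_Y : k⟨⟨X₀, X₁⟩⟩ → k⟨⟨Y₁, Y₂, …⟩⟩`: it "sends all the words ending
in `X₀` to zero and the word `X₀^{n_m-1}X₁ ⋯ X₀^{n₁-1}X₁` (`n₁, …, n_m ∈ ℕ_{>0}`) to
`(-1)^m Y_{n_m} ⋯ Y_{n₁}`" [Furusho2011, §2]. Coefficientwise: the Y-word `Y_{k₁} ⋯ Y_{k_m}` is
the list `[k₁, …, k_m]` of positive integers, whose unique preimage word is
`MZV.binaryWord [k₁, …, k_m]`, so `c_{[k₁,…,k_m]}(π_Y φ) = (-1)^m c_{binaryWord [k₁,…,k_m]}(φ)`;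
lists containing `0` are not Y-words and get the junk value `0`. [cite: Furusho2011, §2] -/
def piY (φ : NCSeries Bool R) : NCSeries ℕ R := fun s =>
  if ∀ i ∈ s, 1 ≤ i then (-1) ^ s.length * φ (MZV.binaryWord s) else 0

/-- `c_s(π_Y φ) = (-1)^{|s|} c_{binaryWord s}(φ)` on Y-words (lists of positive integers).
[cite: Furusho2011, §2] -/
theorem piY_apply_of_forall_pos (φ : NCSeries Bool R) {s : List ℕ} (hs : ∀ i ∈ s, 1 ≤ i) :
    piY φ s = (-1) ^ s.length * φ (MZV.binaryWord s) := if_pos hs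

/-- Lists containing `0` are not Y-words: `π_Y φ` vanishes there (junk convention). [folklore] -/
theorem piY_apply_of_zero_mem (φ : NCSeries Bool R) {s : List ℕ} (hs : 0 ∈ s) : piY φ s = 0 :=
  if_neg fun h => absurd (h 0 hs) (by omega)

/-- `π_Y` preserves the constant term. [folklore] -/
@[simp] theorem piY_apply_nil (φ : NCSeries Bool R) : piY φ [] = φ [] := by
  simp [piY, MZV.binaryWord]

/-- In depth one: `c_{Y_n}(π_Y φ) = -c_{X₀ⁿ⁻¹X₁}(φ)` (`n ≥ 1`). [cite: Furusho2011, §2] -/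
theorem piY_apply_singleton (φ : NCSeries Bool R) {n : ℕ} (hn : 1 ≤ n) :
    piY φ [n] = -φ (MZV.binaryWord [n]) := by
  rw [piY_apply_of_forall_pos φ (by simpa using hn)]
  simp

variable [Algebra ℚ R]

/-- The logarithm of Furusho's correction term: the series
`Σ_{n ≥ 1} ((-1)ⁿ/n) c_{X₀ⁿ⁻¹X₁}(φ) Y₁ⁿ ∈ R⟨⟨Y₁, Y₂, …⟩⟩` (`R` a `ℚ`-algebra), supported on the
words `Y₁ⁿ = [1, …, 1]` (`n ≥ 1` entries); `X₀ⁿ⁻¹X₁ = MZV.binaryWord [n]`.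
[cite: Furusho2011, §2 (correction)] -/
def corrLog (φ : NCSeries Bool R) : NCSeries ℕ R := fun s =>
  if s ≠ [] ∧ ∀ i ∈ s, i = 1 then
    algebraMap ℚ R ((-1) ^ s.length / s.length) * φ (MZV.binaryWord [s.length])
  else 0

/-- `c_{Y₁ⁿ}(corrLog φ) = ((-1)ⁿ/n) c_{X₀ⁿ⁻¹X₁}(φ)` for `n ≥ 1`. [cite: Furusho2011, §2] -/
theorem corrLog_apply_replicate (φ : NCSeries Bool R) {n : ℕ} (hn : n ≠ 0) :
    corrLog φ (List.replicate n 1) =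
      algebraMap ℚ R ((-1) ^ n / n) * φ (MZV.binaryWord [n]) := by
  unfold corrLog
  rw [if_pos ⟨by simpa using hn, fun i hi => (List.eq_of_mem_replicate hi)⟩]
  simp

/-- `corrLog φ` has no constant term. [folklore] -/
@[simp] theorem corrLog_apply_nil (φ : NCSeries Bool R) : corrLog φ [] = 0 := by
  simp [corrLog]

/-- `corrLog φ` vanishes on every word with a letter other than `Y₁`. [folklore] -/
theorem corrLog_apply_eq_zero (φ : NCSeries Bool R) {s : List ℕ} (hs : ∃ i ∈ s, i ≠ 1) :
    corrLog φ s = 0 := by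
  unfold corrLog
  rw [if_neg]
  rintro ⟨-, h⟩
  obtain ⟨i, hi, hne⟩ := hs
  exact hne (h i hi)

/-- Furusho's **correction term** `φ_corr = exp(Σ_{n ≥ 1} ((-1)ⁿ/n) c_{X₀ⁿ⁻¹X₁}(φ) Y₁ⁿ)`
(cf. [Racinet2002, Def. 3.1] with other signs). [cite: Furusho2011, §2 (correction)] -/
def corr (φ : NCSeries Bool R) : NCSeries ℕ R := exp (corrLog φ)

/-- Furusho's **series shuffle regularisation** `φ_* = φ_corr · π_Y(φ) ∈ R⟨⟨Y₁, Y₂, …⟩⟩`.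
[cite: Furusho2011, §2] -/
def seriesShuffleReg (φ : NCSeries Bool R) : NCSeries ℕ R := corr φ * piY φ

/-- The **generalised double shuffle relation** for `φ ∈ R⟨⟨X₀, X₁⟩⟩` (`R` a `ℚ`-algebra)
[Furusho2011, §2, (double shuffle)]: `Δ_*(φ_*) = φ_* ⊗̂ φ_*` for the algebra morphism
`Δ_* : R⟨⟨Y⟩⟩ → R⟨⟨Y⟩⟩^{⊗̂ 2}`, `Δ_*(Y_n) = Σ_{i=0}^{n} Y_i ⊗ Y_{n-i}` (`Y₀ := 1`), where
`φ_* = seriesShuffleReg φ`. As `⟨Δ_* ψ, u ⊗ v⟩ = ⟨ψ, u ∗ v⟩` for Hoffman's harmonic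
(quasi-shuffle) product `∗` of Y-words (Racinet 2002, §2: the graded dual of `(k⟨Y⟩, ·, Δ_*)` is
`QSym`, paragraph before Prop. 2.17; Prop. 2.17 for two letters) and
`⟨ψ ⊗̂ ψ, u ⊗ v⟩ = c_u(ψ) c_v(ψ)`, the relation is recorded coefficientwise:
`c_u(φ_*) c_v(φ_*) = Σ_{w ∈ u ∗ v} c_w(φ_*)` for all Y-words `u, v` (lists of positive integers;
`MZV.stuffle` lists `u ∗ v` with multiplicity). This is Racinet's `Δ_*`-condition of `DMR`
(Racinet 2002, Def. 3.1) up to Furusho's sign changes. For `φ = Φ_KZ` these are the regularised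
harmonic ("stuffle") relations of multiple zeta values. [cite: Furusho2011, §2 (double shuffle)] -/
def GeneralisedDoubleShuffle (φ : NCSeries Bool R) : Prop :=
  ∀ u v : List ℕ, (∀ i ∈ u, 1 ≤ i) → (∀ i ∈ v, 1 ≤ i) →
    seriesShuffleReg φ u * seriesShuffleReg φ v =
      ((MZV.stuffle u v).map (seriesShuffleReg φ)).sum

/-! ### Unfolding `φ_*` -/

/-- The correction term vanishes on every Y-word with a letter other than `Y₁`
(`φ_corr ∈ R[[Y₁]]`). [folklore] -/
theorem corr_apply_eq_zero (φ : NCSeries Bool R) {s : List ℕ} (hs : ∃ i ∈ s, i ≠ 1) :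
    corr φ s = 0 :=
  exp_apply_eq_zero_of_mem (p := fun i => i ≠ 1) (fun _ hw => corrLog_apply_eq_zero φ hw) hs

/-- The correction term has constant term `1`. [folklore] -/
@[simp] theorem corr_apply_nil (φ : NCSeries Bool R) : corr φ [] = 1 := exp_apply_nil _

/-- **`φ_*` on words not starting with `Y₁`**: `c_s(φ_*) = c_s(π_Y φ)` whenever the Y-word `s`
does not begin with `Y₁` — the correction only affects words `Y₁ w`. [cite: Furusho2011, §2] -/
theorem seriesShuffleReg_apply_of_head (φ : NCSeries Bool R) {s : List ℕ}
    (hs : ∀ h : s ≠ [], s.head h ≠ 1) : seriesShuffleReg φ s = piY φ s := by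
  rw [seriesShuffleReg, mul_apply, Finset.sum_eq_single_of_mem ([], s) (nil_self_mem_splits s)]
  · simp
  · rintro ⟨u, v⟩ hp hne
    rw [mem_splits] at hp
    cases u with
    | nil => simp only [List.nil_append] at hp; subst hp; exact absurd rfl hne
    | cons a u =>
      have ha : a ≠ 1 := by
        have h := hs (by rw [← hp]; simp)
        simpa [← hp] using h
      rw [corr_apply_eq_zero φ (s := a :: u) ⟨a, by simp, ha⟩, zero_mul]

/-- **`φ_*` on admissible indices**: for an admissible index `s` (entries `≥ 1`, first entry `≥ 2`,
`MZV.IsAdmissible`), `c_s(φ_*) = (-1)^{depth s} c_{binaryWord s}(φ)` — e.g. for `φ = Φ_KZ` the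
coefficient is `(-1)^{depth} (-1)^{depth} ζ(s) = ζ(s)` up to Furusho's index reversal. This is the
form in which `NCSeries.GeneralisedDoubleShuffle` yields the finite double shuffle (stuffle)
relations among convergent coefficients. [cite: Furusho2011, §2] -/
theorem seriesShuffleReg_apply_of_isAdmissible (φ : NCSeries Bool R) {s : List ℕ}
    (hs : MZV.IsAdmissible s) :
    seriesShuffleReg φ s = (-1) ^ s.length * φ (MZV.binaryWord s) := by
  rw [seriesShuffleReg_apply_of_head φ fun h => ?_, piY_apply_of_forall_pos φ hs.1]
  have := hs.2 h
  omega

/-- `φ_*` has the constant term of `φ`. [folklore] -/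
@[simp] theorem seriesShuffleReg_apply_nil (φ : NCSeries Bool R) : seriesShuffleReg φ [] = φ [] := by
  rw [seriesShuffleReg_apply_of_head φ fun h => absurd rfl h, piY_apply_nil]

/-! ### The trivial solution -/

omit [Algebra ℚ R] in
/-- A binary word of a non-empty index is non-empty. [folklore] -/
theorem binaryWord_cons_ne_nil (a : ℕ) (s : List ℕ) : MZV.binaryWord (a :: s) ≠ [] := by
  simp [MZV.binaryWord]

omit [Algebra ℚ R] in
/-- `π_Y 1 = 1`. [folklore] -/
@[simp] theorem piY_one : piY (1 : NCSeries Bool R) = 1 := by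
  ext s
  cases s with
  | nil => simp
  | cons a s =>
    obtain ⟨b, w, hw⟩ := List.exists_cons_of_ne_nil (binaryWord_cons_ne_nil a s)
    simp only [piY]
    rw [hw, one_apply_cons, one_apply_cons]
    simp

/-- The correction of the unit series is trivial: `corrLog 1 = 0`. [folklore] -/
@[simp] theorem corrLog_one : corrLog (1 : NCSeries Bool R) = 0 := by
  ext s
  obtain ⟨b, w, hw⟩ := List.exists_cons_of_ne_nil (binaryWord_cons_ne_nil s.length [])
  simp only [corrLog]
  rw [hw, one_apply_cons, zero_apply]
  simp

/-- `1_* = 1`. [folklore] -/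
@[simp] theorem seriesShuffleReg_one : seriesShuffleReg (1 : NCSeries Bool R) = 1 := by
  simp [seriesShuffleReg, corr]

/-- The unit series satisfies the generalised double shuffle relation (the unit of `DMR₀`).
[folklore] -/
theorem generalisedDoubleShuffle_one : GeneralisedDoubleShuffle (1 : NCSeries Bool R) := by
  intro u v _ _
  rw [seriesShuffleReg_one]
  cases u with
  | nil => simp
  | cons a u =>
    cases v with
    | nil => simp
    | cons b v =>
      simp only [one_apply_cons, zero_mul, MZV.stuffle_cons_cons, List.map_append, List.map_map,
        List.sum_append]
      simp [Function.comp_def]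

/-! ### Change of coefficients -/

omit [Algebra ℚ R] in
/-- `π_Y` commutes with change of coefficients. [folklore] -/
theorem piY_map {S : Type*} [CommRing S] (f : R →+* S) (φ : NCSeries Bool R) :
    piY (map f φ) = map f (piY φ) := by
  ext s
  by_cases hs : ∀ i ∈ s, 1 ≤ i
  · simp [piY_apply_of_forall_pos _ hs]
  · simp [piY, if_neg hs]

/-- The logarithm of the correction term commutes with change of coefficients between
`ℚ`-algebras. [folklore] -/
theorem corrLog_map {S : Type*} [CommRing S] [Algebra ℚ S] (f : R →+* S) (φ : NCSeries Bool R) :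
    corrLog (map f φ) = map f (corrLog φ) := by
  have hq : ∀ q : ℚ, f (algebraMap ℚ R q) = algebraMap ℚ S q := fun q =>
    RingHom.congr_fun (Subsingleton.elim (f.comp (algebraMap ℚ R)) (algebraMap ℚ S)) q
  ext s
  by_cases hs : s ≠ [] ∧ ∀ i ∈ s, i = 1
  · simp [corrLog, if_pos hs, hq]
  · simp [corrLog, if_neg hs]

/-- `exp` commutes with change of coefficients between `ℚ`-algebras. [folklore] -/
theorem exp_map {α : Type u} {S : Type*} [CommRing S] [Algebra ℚ S] (f : R →+* S)
    (T : NCSeries α R) : exp (map f T) = map f (exp T) := by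
  have hq : ∀ q : ℚ, f (algebraMap ℚ R q) = algebraMap ℚ S q := fun q =>
    RingHom.congr_fun (Subsingleton.elim (f.comp (algebraMap ℚ R)) (algebraMap ℚ S)) q
  ext w
  simp only [exp, map_apply, map_sum, map_mul, hq, ← map_pow]

/-- **`φ_*` commutes with change of coefficients** between `ℚ`-algebras:
`(map f φ)_* = map f (φ_*)`. [folklore] -/
theorem seriesShuffleReg_map {S : Type*} [CommRing S] [Algebra ℚ S] (f : R →+* S)
    (φ : NCSeries Bool R) : seriesShuffleReg (map f φ) = map f (seriesShuffleReg φ) := by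
  rw [seriesShuffleReg, seriesShuffleReg, corr, corr, corrLog_map, exp_map, piY_map, map_mul]

/-- **The generalised double shuffle relation is preserved by change of coefficients.**
[folklore] -/
theorem GeneralisedDoubleShuffle.map {S : Type*} [CommRing S] [Algebra ℚ S] {φ : NCSeries Bool R}
    (h : GeneralisedDoubleShuffle φ) (f : R →+* S) : GeneralisedDoubleShuffle (NCSeries.map f φ) := by
  intro u v hu hv
  rw [seriesShuffleReg_map]
  have h' := congrArg f (h u v hu hv)
  rw [map_mul, map_list_sum, List.map_map] at h'
  exact h'

/-- **Descent along an injective change of coefficients**: if `(map f φ)_*` satisfies the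
generalised double shuffle relation over `S` and `f : R → S` is injective, then `φ_*` satisfies it
over `R` (the relation is a family of polynomial identities in the coefficients). This is the form
in which Furusho's theorem over the residue FIELDS of a reduced `ℚ`-algebra is pulled back.
[folklore] -/
theorem GeneralisedDoubleShuffle.of_map {S : Type*} [CommRing S] [Algebra ℚ S] {φ : NCSeries Bool R}
    {f : R →+* S} (hf : Function.Injective f) (h : GeneralisedDoubleShuffle (NCSeries.map f φ)) :
    GeneralisedDoubleShuffle φ := by
  intro u v hu hv
  apply hf
  have h' := h u v hu hv
  rw [seriesShuffleReg_map] at h'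
  rw [map_mul, map_list_sum, List.map_map]
  exact h'

end DoubleShuffle

end NCSeries

/-! ## 6. Furusho's theorems (named facts) -/

open NCSeries in
/-- **Furusho's theorem: the pentagon equation implies the generalised double shuffle relation**
[Furusho2011, Thm 1.2]: "Let `φ` be a non-commutative formal power series in two variables which is
group-like. Suppose that `φ` satisfies Drinfel'd's pentagon equation (pentagon). Then it also
satisfies the generalized double shuffle relation (double shuffle)." The ground ring is a FIELD
`k` of characteristic `0` ([Furusho2011, §2, first line]); `k` is taken in `Type`.
Consequences: `GRT₁ ↪ DMR₀` (Cor. 1.3), `M_μ ↪ DMR_μ` (Cor. 1.4). Named fact (not proved here).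
[cite: Furusho2011, Thm 1.2] -/
def furusho_pentagon_doubleShuffle : Prop :=
  ∀ (k : Type) [Field k] [CharZero k] (φ : NCSeries Bool k),
    IsGroupLike φ → DrinfeldPentagon φ → GeneralisedDoubleShuffle φ

open NCSeries in
/-- **Furusho's theorem: the pentagon equation implies the hexagon equations**
[Furusho2010, Thm 1]: "Let `φ = φ(X,Y)` be a group-like element of `U𝔉₂ = k⟨⟨X,Y⟩⟩` (`k` a field of
characteristic `0`). Suppose that `φ` satisfies Drinfel'd's pentagon equation. Then there exists an
element (unique up to signature) `μ ∈ k̄` such that the pair `(μ, φ)` satisfies his two hexagon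
equations. Actually this `μ` is equal to `±(24 c₂(φ))^{1/2}`", `c₂(φ)` = the coefficient of
`XY = X₀X₁`. Stated for the base change of `φ` to the algebraic closure `k̄ = AlgebraicClosure k`
(the uniqueness clause is not recorded). Named fact (not proved here). [cite: Furusho2010, Thm 1] -/
def furusho_pentagon_hexagon : Prop :=
  ∀ (k : Type) [Field k] [CharZero k] (φ : NCSeries Bool k),
    IsGroupLike φ → DrinfeldPentagon φ →
      ∃ μ : AlgebraicClosure k,
        μ ^ 2 = 24 * algebraMap k (AlgebraicClosure k) (φ [false, true]) ∧
        DrinfeldHexagon μ (map (algebraMap k (AlgebraicClosure k)) φ) ∧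
        DrinfeldHexagonB μ (map (algebraMap k (AlgebraicClosure k)) φ)

end Literature.NumberTheory.Transcendental

/-! ## 7. Weight one: the pentagon forces `c_{X₀} = c_{X₁} = 0` -/

namespace Literature.NumberTheory.Transcendental

universe u v

namespace NCSeries

section EvalLemmas

variable {α : Type u} {R : Type v} [CommSemiring R] {A : Type*} [Semiring A] [Algebra R A]
  [Fintype α]

/-- In weight `≤ 1`: `evalTrunc 1 v φ = c_∅(φ) · 1 + Σ_a c_a(φ) · v(a)`. [folklore] -/
theorem evalTrunc_one_eq (v : α → A) (φ : NCSeries α R) :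
    evalTrunc 1 v φ = φ [] • (1 : A) + ∑ a, φ [a] • v a := by
  unfold evalTrunc
  rw [Finset.sum_range_succ, Finset.sum_range_one, Fintype.sum_unique, List.ofFn_zero, List.map_nil,
    List.prod_nil]
  congr 1
  rw [← (Equiv.funUnique (Fin 1) α).symm.sum_comp]
  refine Finset.sum_congr rfl fun a _ => ?_
  simp [List.ofFn_succ]

/-- Substitution commutes with algebra maps: `F(φ(v)) = φ(F ∘ v)` weight by weight. [folklore] -/
theorem algHom_evalTrunc {B : Type*} [Semiring B] [Algebra R B] (F : A →ₐ[R] B) (N : ℕ) (v : α → A)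
    (φ : NCSeries α R) : F (evalTrunc N v φ) = evalTrunc N (F ∘ v) φ := by
  simp [evalTrunc, map_sum, map_list_prod, Function.comp_def]

end EvalLemmas

variable {R : Type v} [CommRing R]

/-- **The pentagon forces `c_{X₀}(φ) = c_{X₁}(φ) = 0`** for every series `φ` with constant term `1`
(in particular for group-like `φ`): map the weight-`≤ 1` truncation of `U𝔞₄ ⊗ R` to the
commutative square-zero extension `R ⊕ R^{4 × 4}` (`t_ij ↦ e_ij + e_ji`; all defining relations
hold there) and compare the coefficients of `e₁₂` (giving `c_{X₀} = 2 c_{X₀}`) and of `e₃₄`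
(`c_{X₁} = 2 c_{X₁}`) on the two sides of the pentagon. Hence pentagon solutions with constant term
`1` satisfy the weight-one conditions `c_{X₀} = c_{X₁} = 0` of `DMR` (Furusho 2011, §1, Thm 2.1).
[folklore] -/
theorem DrinfeldPentagon.apply_letter_eq_zero {φ : NCSeries Bool R} (h : DrinfeldPentagon φ)
    (h1 : φ [] = 1) : φ [false] = 0 ∧ φ [true] = 0 := by
  classical
  let v : Fin 4 × Fin 4 → TrivSqZeroExt R (Fin 4 × Fin 4 → R) := fun p =>
    if p.1 = p.2 then 0 else TrivSqZeroExt.inr (Pi.single p 1 + Pi.single p.swap 1)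
  have hv0 : ∀ p, (v p).fst = 0 := fun p => by
    simp only [v]; split_ifs <;> simp
  have hprod : ∀ l : List (TrivSqZeroExt R (Fin 4 × Fin 4 → R)), 2 ≤ l.length →
      (∀ x ∈ l, x.fst = 0) → l.prod = 0 := by
    intro l hl hl0
    match l, hl with
    | a :: b :: rest, _ =>
      have ha : a.fst = 0 := hl0 a (by simp)
      have hb : b.fst = 0 := hl0 b (by simp)
      rw [List.prod_cons, List.prod_cons]
      ext
      · simp [ha]
      · rw [TrivSqZeroExt.snd_mul, ha, TrivSqZeroExt.fst_mul, hb, zero_mul]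
        simp
  obtain ⟨W, hW⟩ : ∃ W : DrinfeldKohnoTrunc R (Fin 4) 1 →ₐ[R] TrivSqZeroExt R (Fin 4 × Fin 4 → R),
      ∀ i j, W (t₄ R 1 i j) = v (i, j) := by
    refine ⟨RingQuot.liftAlgHom R ⟨FreeAlgebra.lift R v, fun a b hab => ?_⟩, fun i j => ?_⟩
    · cases hab with
      | diag i => simp [v]
      | symm i j =>
        simp only [FreeAlgebra.lift_ι_apply, v, Prod.swap_prod_mk]
        by_cases hij : i = j
        · subst hij; rfl
        · rw [if_neg hij, if_neg (Ne.symm hij), add_comm]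
      | fourTerm i j k _ _ _ => simp only [map_mul, map_add]; exact mul_comm _ _
      | locality i j k l _ _ _ _ _ _ => simp only [map_mul]; exact mul_comm _ _
      | trunc g =>
        rw [map_list_prod, map_zero, List.map_ofFn]
        refine hprod _ (by simp) fun x hx => ?_
        rw [List.mem_ofFn] at hx
        obtain ⟨r, rfl⟩ := hx
        simp [hv0]
    · exact (RingQuot.liftAlgHom_mkAlgHom_apply R (FreeAlgebra.lift R v) _ _).trans
        (FreeAlgebra.lift_ι_apply _ _)
  have hp := congrArg W (h 1)
  simp only [map_mul, subst₂, evalTrunc_one_eq, Fintype.sum_bool, bsub_true, bsub_false, map_add,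
    h1, one_smul] at hp
  have h01 := congrArg (fun x : TrivSqZeroExt R (Fin 4 × Fin 4 → R) => x.snd (0, 1)) hp
  have h23 := congrArg (fun x : TrivSqZeroExt R (Fin 4 × Fin 4 → R) => x.snd (2, 3)) hp
  simp [v, hW, TrivSqZeroExt.snd_mul, TrivSqZeroExt.fst_mul, _root_.map_smul] at h01 h23
  exact ⟨h01, h23⟩

/-- In particular a **group-like pentagon solution has `c_{X₀} = c_{X₁} = 0`** (the hypothesis of
Furusho 2011, Thm 2.1, is automatic in Thm 1.2). [folklore] -/
theorem DrinfeldPentagon.apply_letter_eq_zero_of_isGroupLike {φ : NCSeries Bool R}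
    (h : DrinfeldPentagon φ) (hg : IsGroupLike φ) (a : Bool) : φ [a] = 0 := by
  obtain ⟨h0, h1⟩ := h.apply_letter_eq_zero hg.apply_nil
  cases a <;> assumption

end NCSeries

end Literature.NumberTheory.Transcendental
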